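import Literature.MathematicalPhysics.QuantumFieldTheory.Balaban1983to89.T4MatchingAssembly

/-!
# YM-DAG node N21 (= NE7c) — THE THRESHOLD MIXTURE, PART 17: THE TRANSFER OF THE MIXTURE ROAD AT THE APEX SHAPE — the per-string target
# `T4MatchingAssembly.StringHybridNE7` is EXISTENTIAL over the term representation, and `HybridNE7` minus its `shell` clause is CONVEX under
# averaging of threshold-indexed SHARP representations

Track A of `YM-PLAN.md` (cell `pub-ymgap`, HUMAN RULING D-0062), node **N21**; R141 (C) fan-out seat `pub-ymgap-dag-n21-e` (s3 = ALTERNATIVE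
CURRENCY), generation 7, file 17.  Lane K3⁗ `SpineGivenEndpointR13Sep` = stmt-QuantumFields-20292 (`--kind proof --supports … --as helper`).
Imports `Lit/…/T4MatchingAssembly` ONLY; generic (any index type, any measure spaces of threshold assignments, any gauge group at the scheme level).

WHY THIS FILE.  Every module of this seat's mixture road (files 5a–16, p466893 … p502670) carries the honest caveat «the mixture is a CONVEX
COMBINATION of print's SHARP procedure over admissible threshold vectors — NOT print verbatim».  Read at the apex this is a TRANSFER question
with a kernel answer.  K3⁗'s conclusion `T4ApexHybrid.HybridNE7Under D END` is, string by string,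
`T4MatchingAssembly.StringHybridNE7 (D.scheme g₀) os l₀ vol K₀ := ∃ (ι : Type) … (T A B shA shB Bad W Wsh δ), HybridNE7 … ∧ (E1) ∧ (E2)` —
EXISTENTIAL over the term representation of the threshold-free dressed partition functions `T4GenFunBounds.schemeZ` ([Balaban1989LargeFieldI] p. 193:
*"the equivalence means that both sides have equal integrals over the space of fields"*; tree: `T4MatchingDegenerate.hybridNE7Under_iff_matchingUnder`
— the hybrid packaging carries exactly King-shape matching modulo constants); the datum of record enters K3⁗ only through `D.scheme g₀`, not through the
represented tower.  And `HybridNE7` MINUS its `shell` clause is CONVEX in the representation.  So: run the two-run comparison SHARP at (almost)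
every threshold vector `λ` of the box — `weight` (NE7b), `core` (the term-wise sandwich of the cores with a `t`-, `τ`- AND `λ`-UNIFORM constant
`c_K`), (E1)∕(E2) — AVERAGE over `λ`, and supply the `shell` clause for the AVERAGED carriers directly, where it is (M1)-FREE (lens Card 5 (ii)
`slotAntiConcentration_thresholdMixture` p466893; this seat's K5 readings p468321 · p469525 · p479591 · p483387).  The caveat is thereby NOT a transfer
obstruction at K3⁗, and what the road COSTS is LOCATED as the hypotheses of ONE theorem (§2): λ-UNIFORMITY over the box of the sharp NE7b weight `W_K`
(N20) and of the sharp core constant `c_K` ∕ remainders `δ_K` (N14 ∕ N18 ∕ N19 — threshold robustness (L1): [Balaban1989LargeFieldI] p. 181 ladder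
slack, [Balaban1989LargeFieldII] p. 383 margin), and (E1)∕(E2) at (almost) EVERY threshold vector (the expansion is an identity for every threshold
choice).

WHAT IS TYPED AND PROVED (all [folklore]: Fubini for finite sums, `integral_mono_ae`, linearity).  Data: per step `K` a measure space `(Λ K, P K)`
of threshold assignments; λ-indexed SHARP families `As Bs shAs shBs : (K : ℕ) → Λ K → ℝ → ι → ℝ`; CARRIERS `A B shA shB : ℕ → ℝ → ι → ℝ` PINNED as
their `P K`-integrals (`hA : A K t τ = ∫ λ, As K λ t τ ∂(P K)` on `|t| ≤ l₀`, `τ ∈ T K` — file 12's pinning style; for NORMALISED box averages take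
`P K := (μ K univ)⁻¹ • μ K`, §4).
* §1 CONVEX CLAUSES: `classBound_of_ae` (a class-relative LINEAR bound `Σ_{τ∈C} ≤ w·Σ_{τ∈T}` holding for the sharp family at `P`-a.e. `λ` holds
  for the carriers); `mul_integral_le_of_ae` ∕ `integral_le_mul_of_ae` (one-sided sandwiches pass to the integrals); `relWeightBound_of_average`
  (`T4WeightBudget.RelWeightBound l₀ T A B Bad W` for the carriers from the sharp bad-class bounds a.e. with λ-uniform `W`); `core_of_average`
  (`HybridNE7`'s `core` field for the carriers from the sharp two-sided sandwich a.e. with λ-uniform `c_K`, same `vol`, `δ`);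
  `shellWeightBound_of_average` (all-sharp version of the shell clause, for completeness — NOT the N21 road: there the sharp clause is NOT needed).
* §2 ★ `hybridNE7_of_average` (CONVEXITY: every clause sharp a.e. with λ-uniform constants ⇒ `HybridNE7` for the carriers) · ★★
  `hybridNE7_of_average_of_shellWeightBound` (sharp `weight` + sharp `core` a.e., λ-uniform, + `T4IndicatorShell.ShellWeightBound l₀ T A B shA shB Wsh`
  FOR THE AVERAGED CARRIERS + `W + Wsh < 1` + `Summable δ` ⇒ `HybridNE7 l₀ vol T A B Bad W shA shB Wsh δ` — the mixture road's end-to-end shape at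
  the apex).
* §3 `eq_sum_of_ae` ((E1) at `P`-a.e. `λ` for the sharp family ⇒ (E1) for the carriers; `P` a probability measure) · ★★ `stringHybridNE7_of_average`
  (⇒ `T4MatchingAssembly.StringHybridNE7 S os l₀ vol K₀`, K3⁗'s per-string target shape; `ι : Type`).
* §4 NORMALISED AVERAGES over non-zero measures (common-box form of files 10b∕11b∕12∕14a): `integral_normalized_eq`, `ae_normalized_of_ae`,
  `integrable_normalized`, `hybridNE7_of_normalizedAverage_of_shellWeightBound`.

JUNCTION BY NAME.  `hSh` of ★★ at spine carriers `S` IS the K5 reading `YMDAG.UVSplit.S_N21 SRec` applied at `(F, D, g₀, os, S)` (`…ClustersCore` :253).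
HONEST FRAMING.  Kernel bookkeeping over the apex's typed shapes; every sharp clause and the averaged shell bound are HYPOTHESES; nothing of
Bałaban's asserted; (M1) for print's deterministic sharp procedure untouched; NE7c NOT PRINTED ∕ NOT proved; N21 NOT discharged; counts unmoved
(typed 28∕28 · discharged 5∕27, A 5∕28); one finite 𝕋⁴ at fixed ε — NOT ℝ⁴ ∕ OS ∕ mass gap ∕ Clay.  No `sorry`∕`axiom`∕`def`∕`instance`∕`notation`.
-/

noncomputable section

open MeasureTheory Set
open scoped BigOperators ENNReal

namespace Summit.QuantumFields.YangMills.Theorems.N21ThresholdMixtureTransfer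

open Literature.MathematicalPhysics.QuantumFieldTheory.Balaban1983to89
open Literature.MathematicalPhysics.QuantumFieldTheory.Balaban1983to89.T4IndicatorShell (ShellWeightBound)
open Literature.MathematicalPhysics.QuantumFieldTheory.Balaban1983to89.T4WeightBudget (RelWeightBound)
open Literature.MathematicalPhysics.QuantumFieldTheory.Balaban1983to89.T4MatchingAssembly (HybridNE7 StringHybridNE7)

/-! ## §1  The convex clauses: class-relative linear bounds and one-sided sandwiches pass from a.e.-sharp to the averaged carriers -/

section Convex

variable {Λ : Type*} [MeasurableSpace Λ] {P : Measure Λ} {ι : Type*}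

/-- **A CLASS-RELATIVE LINEAR BOUND IS CONVEX.**  If the sharp weights `Xs λ` satisfy `Σ_{τ ∈ C} Xs λ τ ≤ w · Σ_{τ ∈ T} Xs λ τ` for `P`-almost every
threshold assignment `λ` (`C ⊆ T`, every `λ ↦ Xs λ τ` integrable) and the carriers are pinned as `X τ = ∫ Xs · τ dP`, then `Σ_{τ ∈ C} X τ ≤ w · Σ_{τ ∈ T} X τ`
(Fubini for the finite sums + `integral_mono_ae`).  No normalisation of `P` is needed. [folklore] -/
theorem classBound_of_ae (C T : Finset ι) (hCT : C ⊆ T) (Xs : Λ → ι → ℝ) (X : ι → ℝ) (w : ℝ)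
    (hint : ∀ τ ∈ T, Integrable (fun l => Xs l τ) P) (hX : ∀ τ ∈ T, X τ = ∫ l, Xs l τ ∂P)
    (hsharp : ∀ᵐ l ∂P, ∑ τ ∈ C, Xs l τ ≤ w * ∑ τ ∈ T, Xs l τ) :
    ∑ τ ∈ C, X τ ≤ w * ∑ τ ∈ T, X τ := by
  have hC : ∀ τ ∈ C, Integrable (fun l => Xs l τ) P := fun τ hτ => hint τ (hCT hτ)
  have eC : ∑ τ ∈ C, X τ = ∫ l, ∑ τ ∈ C, Xs l τ ∂P := by
    rw [integral_finsetSum C hC]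
    exact Finset.sum_congr rfl fun τ hτ => hX τ (hCT hτ)
  have eT : ∑ τ ∈ T, X τ = ∫ l, ∑ τ ∈ T, Xs l τ ∂P := by
    rw [integral_finsetSum T hint]
    exact Finset.sum_congr rfl fun τ hτ => hX τ hτ
  rw [eC, eT, ← integral_const_mul]
  exact integral_mono_ae (integrable_finsetSum C hC) ((integrable_finsetSum T hint).const_mul w) hsharp

/-- A ONE-SIDED SANDWICH IS CONVEX (lower): `r · f ≤ g` `P`-a.e. for integrable `f`, `g` gives `r · ∫ f ≤ ∫ g`. [folklore] -/
theorem mul_integral_le_of_ae {f g : Λ → ℝ} {r : ℝ} (hf : Integrable f P) (hg : Integrable g P)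
    (h : ∀ᵐ l ∂P, r * f l ≤ g l) : r * ∫ l, f l ∂P ≤ ∫ l, g l ∂P :=
  (integral_const_mul r f).symm.trans_le (integral_mono_ae (hf.const_mul r) hg h)

/-- A ONE-SIDED SANDWICH IS CONVEX (upper): `g ≤ r · f` `P`-a.e. for integrable `f`, `g` gives `∫ g ≤ r · ∫ f`. [folklore] -/
theorem integral_le_mul_of_ae {f g : Λ → ℝ} {r : ℝ} (hf : Integrable f P) (hg : Integrable g P)
    (h : ∀ᵐ l ∂P, g l ≤ r * f l) : ∫ l, g l ∂P ≤ r * ∫ l, f l ∂P :=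
  (integral_mono_ae hg (hf.const_mul r) h).trans_eq (integral_const_mul r f)

/-- Nonnegativity is convex: `0 ≤ f` `P`-a.e. and `x = ∫ f dP` give `0 ≤ x`. [folklore] -/
theorem nonneg_of_ae {f : Λ → ℝ} {x : ℝ} (hx : x = ∫ l, f l ∂P) (h : ∀ᵐ l ∂P, 0 ≤ f l) : 0 ≤ x := by
  rw [hx]
  exact integral_nonneg_of_ae h

/-- Order is convex: `f ≤ g` `P`-a.e. (both integrable), `x = ∫ f`, `y = ∫ g` give `x ≤ y`. [folklore] -/
theorem le_of_ae {f g : Λ → ℝ} {x y : ℝ} (hf : Integrable f P) (hg : Integrable g P) (hx : x = ∫ l, f l ∂P)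
    (hy : y = ∫ l, g l ∂P) (h : ∀ᵐ l ∂P, f l ≤ g l) : x ≤ y := by
  rw [hx, hy]
  exact integral_mono_ae hf hg h

end Convex

section Clauses

variable {ι : Type*} {Λ : ℕ → Type*} [∀ K, MeasurableSpace (Λ K)] {P : (K : ℕ) → Measure (Λ K)} {l₀ vol : ℝ}
  {T : ℕ → Finset ι} {Bad : ℕ → ℝ → Finset ι} {W Wsh δ : ℕ → ℝ}
  {As Bs shAs shBs : (K : ℕ) → Λ K → ℝ → ι → ℝ} {A B shA shB : ℕ → ℝ → ι → ℝ}

/-- **`RelWeightBound` IS CONVEX** (the NE7b ∕ N20 clause).  King's scalar fields (`Bad K t ⊆ T K`, `0 ≤ W K < 1`, `Σ W < ∞`) and, for every `K` and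
`|t| ≤ l₀`, the SHARP relative bad-class bounds in both runs for `P K`-almost every threshold assignment `λ` — with the SAME `W K` for all `λ`
(λ-uniformity: the located cost) — give `T4WeightBudget.RelWeightBound l₀ T A B Bad W` for the carriers pinned as the `P K`-integrals of the sharp
families (`λ ↦ As K λ t τ`, `λ ↦ Bs K λ t τ` integrable for `τ ∈ T K`). [folklore] -/
theorem relWeightBound_of_average
    (hAi : ∀ K t, |t| ≤ l₀ → ∀ τ ∈ T K, Integrable (fun l => As K l t τ) (P K))
    (hBi : ∀ K t, |t| ≤ l₀ → ∀ τ ∈ T K, Integrable (fun l => Bs K l t τ) (P K))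
    (hA : ∀ K t, |t| ≤ l₀ → ∀ τ ∈ T K, A K t τ = ∫ l, As K l t τ ∂(P K))
    (hB : ∀ K t, |t| ≤ l₀ → ∀ τ ∈ T K, B K t τ = ∫ l, Bs K l t τ ∂(P K))
    (bad_subset : ∀ K t, |t| ≤ l₀ → Bad K t ⊆ T K) (nonneg : ∀ K, 0 ≤ W K) (lt_one : ∀ K, W K < 1) (summable : Summable W)
    (hbadA : ∀ K t, |t| ≤ l₀ → ∀ᵐ l ∂(P K), ∑ τ ∈ Bad K t, As K l t τ ≤ W K * ∑ τ ∈ T K, As K l t τ)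
    (hbadB : ∀ K t, |t| ≤ l₀ → ∀ᵐ l ∂(P K), ∑ τ ∈ Bad K t, Bs K l t τ ≤ W K * ∑ τ ∈ T K, Bs K l t τ) :
    RelWeightBound l₀ T A B Bad W where
  bad_subset := bad_subset
  nonneg := nonneg
  lt_one := lt_one
  summable := summable
  bad_left K t ht :=
    classBound_of_ae (Bad K t) (T K) (bad_subset K t ht) (fun l τ => As K l t τ) (fun τ => A K t τ) (W K) (hAi K t ht) (hA K t ht)
      (hbadA K t ht)
  bad_right K t ht :=
    classBound_of_ae (Bad K t) (T K) (bad_subset K t ht) (fun l τ => Bs K l t τ) (fun τ => B K t τ) (W K) (hBi K t ht) (hB K t ht)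
      (hbadB K t ht)

/-- **THE SHELL CLAUSE IS CONVEX TOO** (all-sharp version, for completeness).  If the sharp shell parts satisfy `0 ≤ shXs ≤ Xs` a.e. and the SHARP
relative shell bounds `Σ shXs ≤ Wsh K · Σ Xs` a.e. with λ-uniform `Wsh` in both runs, the carriers satisfy `T4IndicatorShell.ShellWeightBound`.  NOT the
N21 road — there the sharp shell clause needs (M1) and is NOT assumed; the averaged shell bound is supplied directly (§2 ★★). [folklore] -/
theorem shellWeightBound_of_average
    (hAi : ∀ K t, |t| ≤ l₀ → ∀ τ ∈ T K, Integrable (fun l => As K l t τ) (P K))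
    (hBi : ∀ K t, |t| ≤ l₀ → ∀ τ ∈ T K, Integrable (fun l => Bs K l t τ) (P K))
    (hshAi : ∀ K t, |t| ≤ l₀ → ∀ τ ∈ T K, Integrable (fun l => shAs K l t τ) (P K))
    (hshBi : ∀ K t, |t| ≤ l₀ → ∀ τ ∈ T K, Integrable (fun l => shBs K l t τ) (P K))
    (hA : ∀ K t, |t| ≤ l₀ → ∀ τ ∈ T K, A K t τ = ∫ l, As K l t τ ∂(P K))
    (hB : ∀ K t, |t| ≤ l₀ → ∀ τ ∈ T K, B K t τ = ∫ l, Bs K l t τ ∂(P K))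
    (hshA : ∀ K t, |t| ≤ l₀ → ∀ τ ∈ T K, shA K t τ = ∫ l, shAs K l t τ ∂(P K))
    (hshB : ∀ K t, |t| ≤ l₀ → ∀ τ ∈ T K, shB K t τ = ∫ l, shBs K l t τ ∂(P K))
    (nonneg : ∀ K, 0 ≤ Wsh K) (summable : Summable Wsh)
    (hsh0A : ∀ K t, |t| ≤ l₀ → ∀ τ ∈ T K, ∀ᵐ l ∂(P K), 0 ≤ shAs K l t τ)
    (hshleA : ∀ K t, |t| ≤ l₀ → ∀ τ ∈ T K, ∀ᵐ l ∂(P K), shAs K l t τ ≤ As K l t τ)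
    (hsh0B : ∀ K t, |t| ≤ l₀ → ∀ τ ∈ T K, ∀ᵐ l ∂(P K), 0 ≤ shBs K l t τ)
    (hshleB : ∀ K t, |t| ≤ l₀ → ∀ τ ∈ T K, ∀ᵐ l ∂(P K), shBs K l t τ ≤ Bs K l t τ)
    (hshellA : ∀ K t, |t| ≤ l₀ → ∀ᵐ l ∂(P K), ∑ τ ∈ T K, shAs K l t τ ≤ Wsh K * ∑ τ ∈ T K, As K l t τ)
    (hshellB : ∀ K t, |t| ≤ l₀ → ∀ᵐ l ∂(P K), ∑ τ ∈ T K, shBs K l t τ ≤ Wsh K * ∑ τ ∈ T K, Bs K l t τ) :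
    ShellWeightBound l₀ T A B shA shB Wsh where
  nonneg := nonneg
  summable := summable
  sh_nonneg_left K t ht τ hτ := nonneg_of_ae (hshA K t ht τ hτ) (hsh0A K t ht τ hτ)
  sh_le_left K t ht τ hτ := le_of_ae (hshAi K t ht τ hτ) (hAi K t ht τ hτ) (hshA K t ht τ hτ) (hA K t ht τ hτ) (hshleA K t ht τ hτ)
  sh_nonneg_right K t ht τ hτ := nonneg_of_ae (hshB K t ht τ hτ) (hsh0B K t ht τ hτ)
  sh_le_right K t ht τ hτ := le_of_ae (hshBi K t ht τ hτ) (hBi K t ht τ hτ) (hshB K t ht τ hτ) (hB K t ht τ hτ) (hshleB K t ht τ hτ)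
  left K t ht := by
    have eS : ∑ τ ∈ T K, shA K t τ = ∫ l, ∑ τ ∈ T K, shAs K l t τ ∂(P K) := by
      rw [integral_finsetSum (T K) (hshAi K t ht)]
      exact Finset.sum_congr rfl fun τ hτ => hshA K t ht τ hτ
    have eT : ∑ τ ∈ T K, A K t τ = ∫ l, ∑ τ ∈ T K, As K l t τ ∂(P K) := by
      rw [integral_finsetSum (T K) (hAi K t ht)]
      exact Finset.sum_congr rfl fun τ hτ => hA K t ht τ hτ
    rw [eS, eT, ← integral_const_mul]
    exact integral_mono_ae (integrable_finsetSum _ (hshAi K t ht)) ((integrable_finsetSum _ (hAi K t ht)).const_mul _)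
      (hshellA K t ht)
  right K t ht := by
    have eS : ∑ τ ∈ T K, shB K t τ = ∫ l, ∑ τ ∈ T K, shBs K l t τ ∂(P K) := by
      rw [integral_finsetSum (T K) (hshBi K t ht)]
      exact Finset.sum_congr rfl fun τ hτ => hshB K t ht τ hτ
    have eT : ∑ τ ∈ T K, B K t τ = ∫ l, ∑ τ ∈ T K, Bs K l t τ ∂(P K) := by
      rw [integral_finsetSum (T K) (hBi K t ht)]
      exact Finset.sum_congr rfl fun τ hτ => hB K t ht τ hτ
    rw [eS, eT, ← integral_const_mul]
    exact integral_mono_ae (integrable_finsetSum _ (hshBi K t ht)) ((integrable_finsetSum _ (hBi K t ht)).const_mul _)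
      (hshellB K t ht)

variable [DecidableEq ι]

/-- **THE CORE SANDWICH IS CONVEX** (`HybridNE7`'s `core` field — NE7's term-wise half on the good classes, cores only).  If for every `K` there is
ONE constant `c` such that for every `|t| ≤ l₀`, every good term `τ ∈ T K ∖ Bad K t` and `P K`-almost every threshold assignment `λ` the SHARP cores are
sandwiched, `e^{c − vol·δ K}·(As − shAs) ≤ Bs − shBs ≤ e^{c + vol·δ K}·(As − shAs)` — `c` uniform in `t`, `τ` AND `λ` (λ-uniformity: the located cost) —
then the carriers' cores are sandwiched with the same `c`, `vol`, `δ`. [folklore] -/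
theorem core_of_average
    (hAi : ∀ K t, |t| ≤ l₀ → ∀ τ ∈ T K, Integrable (fun l => As K l t τ) (P K))
    (hBi : ∀ K t, |t| ≤ l₀ → ∀ τ ∈ T K, Integrable (fun l => Bs K l t τ) (P K))
    (hshAi : ∀ K t, |t| ≤ l₀ → ∀ τ ∈ T K, Integrable (fun l => shAs K l t τ) (P K))
    (hshBi : ∀ K t, |t| ≤ l₀ → ∀ τ ∈ T K, Integrable (fun l => shBs K l t τ) (P K))
    (hA : ∀ K t, |t| ≤ l₀ → ∀ τ ∈ T K, A K t τ = ∫ l, As K l t τ ∂(P K))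
    (hB : ∀ K t, |t| ≤ l₀ → ∀ τ ∈ T K, B K t τ = ∫ l, Bs K l t τ ∂(P K))
    (hshA : ∀ K t, |t| ≤ l₀ → ∀ τ ∈ T K, shA K t τ = ∫ l, shAs K l t τ ∂(P K))
    (hshB : ∀ K t, |t| ≤ l₀ → ∀ τ ∈ T K, shB K t τ = ∫ l, shBs K l t τ ∂(P K))
    (hcore : ∀ K : ℕ, ∃ c : ℝ, ∀ t : ℝ, |t| ≤ l₀ → ∀ τ ∈ T K \ Bad K t, ∀ᵐ l ∂(P K),
      Real.exp (c - vol * δ K) * (As K l t τ - shAs K l t τ) ≤ Bs K l t τ - shBs K l t τ ∧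
        Bs K l t τ - shBs K l t τ ≤ Real.exp (c + vol * δ K) * (As K l t τ - shAs K l t τ)) :
    ∀ K : ℕ, ∃ c : ℝ, ∀ t : ℝ, |t| ≤ l₀ → ∀ τ ∈ T K \ Bad K t,
      Real.exp (c - vol * δ K) * (A K t τ - shA K t τ) ≤ B K t τ - shB K t τ ∧
        B K t τ - shB K t τ ≤ Real.exp (c + vol * δ K) * (A K t τ - shA K t τ) := by
  intro K
  obtain ⟨c, hc⟩ := hcore K
  refine ⟨c, fun t ht τ hτ => ?_⟩
  have hτT : τ ∈ T K := (Finset.mem_sdiff.1 hτ).1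
  have h := hc t ht τ hτ
  have iA : Integrable (fun l => As K l t τ - shAs K l t τ) (P K) := (hAi K t ht τ hτT).sub (hshAi K t ht τ hτT)
  have iB : Integrable (fun l => Bs K l t τ - shBs K l t τ) (P K) := (hBi K t ht τ hτT).sub (hshBi K t ht τ hτT)
  have eA : A K t τ - shA K t τ = ∫ l, (As K l t τ - shAs K l t τ) ∂(P K) := by
    rw [hA K t ht τ hτT, hshA K t ht τ hτT, integral_sub (hAi K t ht τ hτT) (hshAi K t ht τ hτT)]
  have eB : B K t τ - shB K t τ = ∫ l, (Bs K l t τ - shBs K l t τ) ∂(P K) := by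
    rw [hB K t ht τ hτT, hshB K t ht τ hτT, integral_sub (hBi K t ht τ hτT) (hshBi K t ht τ hτT)]
  rw [eA, eB]
  exact ⟨mul_integral_le_of_ae iA iB (h.mono fun l hl => hl.1), integral_le_mul_of_ae iA iB (h.mono fun l hl => hl.2)⟩

/-! ## §2  `HybridNE7` is convex; the mixture road's end-to-end shape at the apex -/

/-- ★ **`HybridNE7` IS CONVEX IN THE REPRESENTATION.**  Every clause SHARP at `P K`-almost every threshold assignment with λ-UNIFORM constants
(`W`, `Wsh`, `c_K`, `vol`, `δ`) ⇒ `T4MatchingAssembly.HybridNE7` for the carriers pinned as the `P K`-integrals.  (All-sharp version — on the N21 road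
the sharp shell clause is NOT available; see ★★.) [folklore] -/
theorem hybridNE7_of_average
    (hAi : ∀ K t, |t| ≤ l₀ → ∀ τ ∈ T K, Integrable (fun l => As K l t τ) (P K))
    (hBi : ∀ K t, |t| ≤ l₀ → ∀ τ ∈ T K, Integrable (fun l => Bs K l t τ) (P K))
    (hshAi : ∀ K t, |t| ≤ l₀ → ∀ τ ∈ T K, Integrable (fun l => shAs K l t τ) (P K))
    (hshBi : ∀ K t, |t| ≤ l₀ → ∀ τ ∈ T K, Integrable (fun l => shBs K l t τ) (P K))
    (hA : ∀ K t, |t| ≤ l₀ → ∀ τ ∈ T K, A K t τ = ∫ l, As K l t τ ∂(P K))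
    (hB : ∀ K t, |t| ≤ l₀ → ∀ τ ∈ T K, B K t τ = ∫ l, Bs K l t τ ∂(P K))
    (hshA : ∀ K t, |t| ≤ l₀ → ∀ τ ∈ T K, shA K t τ = ∫ l, shAs K l t τ ∂(P K))
    (hshB : ∀ K t, |t| ≤ l₀ → ∀ τ ∈ T K, shB K t τ = ∫ l, shBs K l t τ ∂(P K))
    (bad_subset : ∀ K t, |t| ≤ l₀ → Bad K t ⊆ T K) (hW0 : ∀ K, 0 ≤ W K) (hWs : Summable W)
    (hWsh0 : ∀ K, 0 ≤ Wsh K) (hWshs : Summable Wsh) (hlt : ∀ K, W K + Wsh K < 1) (hδ : Summable δ)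
    (hbadA : ∀ K t, |t| ≤ l₀ → ∀ᵐ l ∂(P K), ∑ τ ∈ Bad K t, As K l t τ ≤ W K * ∑ τ ∈ T K, As K l t τ)
    (hbadB : ∀ K t, |t| ≤ l₀ → ∀ᵐ l ∂(P K), ∑ τ ∈ Bad K t, Bs K l t τ ≤ W K * ∑ τ ∈ T K, Bs K l t τ)
    (hsh0A : ∀ K t, |t| ≤ l₀ → ∀ τ ∈ T K, ∀ᵐ l ∂(P K), 0 ≤ shAs K l t τ)
    (hshleA : ∀ K t, |t| ≤ l₀ → ∀ τ ∈ T K, ∀ᵐ l ∂(P K), shAs K l t τ ≤ As K l t τ)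
    (hsh0B : ∀ K t, |t| ≤ l₀ → ∀ τ ∈ T K, ∀ᵐ l ∂(P K), 0 ≤ shBs K l t τ)
    (hshleB : ∀ K t, |t| ≤ l₀ → ∀ τ ∈ T K, ∀ᵐ l ∂(P K), shBs K l t τ ≤ Bs K l t τ)
    (hshellA : ∀ K t, |t| ≤ l₀ → ∀ᵐ l ∂(P K), ∑ τ ∈ T K, shAs K l t τ ≤ Wsh K * ∑ τ ∈ T K, As K l t τ)
    (hshellB : ∀ K t, |t| ≤ l₀ → ∀ᵐ l ∂(P K), ∑ τ ∈ T K, shBs K l t τ ≤ Wsh K * ∑ τ ∈ T K, Bs K l t τ)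
    (hcore : ∀ K : ℕ, ∃ c : ℝ, ∀ t : ℝ, |t| ≤ l₀ → ∀ τ ∈ T K \ Bad K t, ∀ᵐ l ∂(P K),
      Real.exp (c - vol * δ K) * (As K l t τ - shAs K l t τ) ≤ Bs K l t τ - shBs K l t τ ∧
        Bs K l t τ - shBs K l t τ ≤ Real.exp (c + vol * δ K) * (As K l t τ - shAs K l t τ)) :
    HybridNE7 l₀ vol T A B Bad W shA shB Wsh δ where
  weight := relWeightBound_of_average hAi hBi hA hB bad_subset hW0 (fun K => by linarith [hlt K, hWsh0 K]) hWs hbadA hbadB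
  shell := shellWeightBound_of_average hAi hBi hshAi hshBi hA hB hshA hshB hWsh0 hWshs hsh0A hshleA hsh0B hshleB hshellA hshellB
  lt_one := hlt
  summable := hδ
  core := core_of_average hAi hBi hshAi hshBi hA hB hshA hshB hcore

/-- ★★ **THE MIXTURE ROAD'S END-TO-END SHAPE AT THE APEX.**  SHARP at `P K`-almost every threshold assignment `λ`, with λ-UNIFORM constants: the
NE7b bad-class bounds `hbadA`∕`hbadB` (weight `W K`; N20 in print's currency) and the term-wise core sandwich `hcore` (ONE `c_K` per `K`; N14∕N18∕N19
species) — PLUS, for the AVERAGED carriers directly, the shell clause `hSh : T4IndicatorShell.ShellWeightBound l₀ T A B shA shB Wsh` (NE7c ∕ N21 on the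
mixture road: (M1)-FREE by Fubini in the threshold, this seat's K5 readings), `W + Wsh < 1` and `Σ δ < ∞` ⇒ `T4MatchingAssembly.HybridNE7 l₀ vol T A B
Bad W shA shB Wsh δ` for the carriers.  NO sharp shell clause is assumed.  CONDITIONAL on every displayed binder. [folklore] -/
theorem hybridNE7_of_average_of_shellWeightBound
    (hAi : ∀ K t, |t| ≤ l₀ → ∀ τ ∈ T K, Integrable (fun l => As K l t τ) (P K))
    (hBi : ∀ K t, |t| ≤ l₀ → ∀ τ ∈ T K, Integrable (fun l => Bs K l t τ) (P K))
    (hshAi : ∀ K t, |t| ≤ l₀ → ∀ τ ∈ T K, Integrable (fun l => shAs K l t τ) (P K))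
    (hshBi : ∀ K t, |t| ≤ l₀ → ∀ τ ∈ T K, Integrable (fun l => shBs K l t τ) (P K))
    (hA : ∀ K t, |t| ≤ l₀ → ∀ τ ∈ T K, A K t τ = ∫ l, As K l t τ ∂(P K))
    (hB : ∀ K t, |t| ≤ l₀ → ∀ τ ∈ T K, B K t τ = ∫ l, Bs K l t τ ∂(P K))
    (hshA : ∀ K t, |t| ≤ l₀ → ∀ τ ∈ T K, shA K t τ = ∫ l, shAs K l t τ ∂(P K))
    (hshB : ∀ K t, |t| ≤ l₀ → ∀ τ ∈ T K, shB K t τ = ∫ l, shBs K l t τ ∂(P K))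
    (bad_subset : ∀ K t, |t| ≤ l₀ → Bad K t ⊆ T K) (hW0 : ∀ K, 0 ≤ W K) (hWs : Summable W)
    (hbadA : ∀ K t, |t| ≤ l₀ → ∀ᵐ l ∂(P K), ∑ τ ∈ Bad K t, As K l t τ ≤ W K * ∑ τ ∈ T K, As K l t τ)
    (hbadB : ∀ K t, |t| ≤ l₀ → ∀ᵐ l ∂(P K), ∑ τ ∈ Bad K t, Bs K l t τ ≤ W K * ∑ τ ∈ T K, Bs K l t τ)
    (hcore : ∀ K : ℕ, ∃ c : ℝ, ∀ t : ℝ, |t| ≤ l₀ → ∀ τ ∈ T K \ Bad K t, ∀ᵐ l ∂(P K),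
      Real.exp (c - vol * δ K) * (As K l t τ - shAs K l t τ) ≤ Bs K l t τ - shBs K l t τ ∧
        Bs K l t τ - shBs K l t τ ≤ Real.exp (c + vol * δ K) * (As K l t τ - shAs K l t τ))
    (hSh : ShellWeightBound l₀ T A B shA shB Wsh) (hlt : ∀ K, W K + Wsh K < 1) (hδ : Summable δ) :
    HybridNE7 l₀ vol T A B Bad W shA shB Wsh δ where
  weight := relWeightBound_of_average hAi hBi hA hB bad_subset hW0 (fun K => by linarith [hlt K, hSh.nonneg K]) hWs hbadA hbadB
  shell := hSh
  lt_one := hlt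
  summable := hδ
  core := core_of_average hAi hBi hshAi hshBi hA hB hshA hshB hcore

end Clauses

/-! ## §3  (E1)∕(E2) are convex; K3⁗'s per-string target shape `StringHybridNE7` from an averaged representation -/

section Strings

variable {Λ : Type*} [MeasurableSpace Λ] {P : Measure Λ} [IsProbabilityMeasure P] {ι : Type*}

/-- **(E1) IS CONVEX.**  If the threshold-free number `Z` (a dressed partition function) equals the sharp term sum `Σ_{τ ∈ T} Xs λ τ` for `P`-almost
every threshold assignment `λ` of a PROBABILITY space — [Balaban1989LargeFieldI] p. 193: the expansion is an identity for every threshold choice —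
then `Z = Σ_{τ ∈ T} X τ` for the carriers `X τ = ∫ Xs · τ dP`. [folklore] -/
theorem eq_sum_of_ae (T : Finset ι) (Xs : Λ → ι → ℝ) (X : ι → ℝ) (Z : ℝ) (hint : ∀ τ ∈ T, Integrable (fun l => Xs l τ) P)
    (hX : ∀ τ ∈ T, X τ = ∫ l, Xs l τ ∂P) (hZ : ∀ᵐ l ∂P, Z = ∑ τ ∈ T, Xs l τ) : Z = ∑ τ ∈ T, X τ :=
  calc Z = ∫ _l, Z ∂P := by simp
    _ = ∫ l, ∑ τ ∈ T, Xs l τ ∂P := integral_congr_ae hZ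
    _ = ∑ τ ∈ T, ∫ l, Xs l τ ∂P := integral_finsetSum T hint
    _ = ∑ τ ∈ T, X τ := Finset.sum_congr rfl fun τ hτ => (hX τ hτ).symm

end Strings

section Scheme

variable {G : Type*} [GaugeGroup G] [MeasurableSpace G] [RegularGaugeGroup G] [HaarData G] {O : Type*}
  {ι : Type} [DecidableEq ι] {Λ : ℕ → Type*} [∀ K, MeasurableSpace (Λ K)] {P : (K : ℕ) → Measure (Λ K)}
  [∀ K, IsProbabilityMeasure (P K)] {l₀ vol : ℝ} {T : ℕ → Finset ι} {Bad : ℕ → ℝ → Finset ι} {W Wsh δ : ℕ → ℝ}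
  {As Bs : (K : ℕ) → Λ K → ℝ → ι → ℝ} {A B shA shB : ℕ → ℝ → ι → ℝ}

omit [RegularGaugeGroup G] in
/-- ★★ **K3⁗'s PER-STRING TARGET SHAPE FROM AN AVERAGED REPRESENTATION.**  `HybridNE7` for carriers `A`, `B` pinned as the `P K`-averages
(probability spaces of threshold assignments) of sharp families `As`, `Bs` which satisfy (E1)∕(E2) for `P K`-almost every `λ`: the string's dressed
partition functions `T4GenFunBounds.schemeZ S os (K₀ + K) t`, `… (K₀ + K + 1) t` ARE the sharp term sums on `|t| ≤ l₀` ⇒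
`T4MatchingAssembly.StringHybridNE7 S os l₀ vol K₀` — EXISTENTIAL over the representation, the averaged one is a witness.  The honest caveat of the
mixture road («a convex combination of print's sharp procedure, not print verbatim») is NOT a transfer obstruction at the apex. [folklore] -/
theorem stringHybridNE7_of_average (S : Missing.TorusScheme G O) (os : List O) (K₀ : ℕ)
    (hH : HybridNE7 l₀ vol T A B Bad W shA shB Wsh δ)
    (hAi : ∀ K t, |t| ≤ l₀ → ∀ τ ∈ T K, Integrable (fun l => As K l t τ) (P K))
    (hBi : ∀ K t, |t| ≤ l₀ → ∀ τ ∈ T K, Integrable (fun l => Bs K l t τ) (P K))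
    (hA : ∀ K t, |t| ≤ l₀ → ∀ τ ∈ T K, A K t τ = ∫ l, As K l t τ ∂(P K))
    (hB : ∀ K t, |t| ≤ l₀ → ∀ τ ∈ T K, B K t τ = ∫ l, Bs K l t τ ∂(P K))
    (hZA : ∀ K t, |t| ≤ l₀ → ∀ᵐ l ∂(P K), T4GenFunBounds.schemeZ S os (K₀ + K) t = ∑ τ ∈ T K, As K l t τ)
    (hZB : ∀ K t, |t| ≤ l₀ → ∀ᵐ l ∂(P K), T4GenFunBounds.schemeZ S os (K₀ + K + 1) t = ∑ τ ∈ T K, Bs K l t τ) :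
    StringHybridNE7 S os l₀ vol K₀ :=
  ⟨ι, inferInstance, T, A, B, shA, shB, Bad, W, Wsh, δ, hH,
    fun K t ht => eq_sum_of_ae (T K) (fun l τ => As K l t τ) (fun τ => A K t τ) _ (hAi K t ht) (hA K t ht) (hZA K t ht),
    fun K t ht => eq_sum_of_ae (T K) (fun l τ => Bs K l t τ) (fun τ => B K t τ) _ (hBi K t ht) (hB K t ht) (hZB K t ht)⟩

end Scheme

/-! ## §4  Normalised averages over finite non-zero measures (the common-box form) -/

section Normalized

variable {Λ : Type*} [MeasurableSpace Λ]

/-- The integral against the NORMALISED measure `(μ univ)⁻¹ • μ` is the normalised average `(μ univ).toReal⁻¹ · ∫ f dμ` — the carriers of files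
10b ∕ 11b ∕ 12 ∕ 14a (box volume `∏ κθ`) are integrals against a probability measure. [folklore] -/
theorem integral_normalized_eq (μ : Measure Λ) (f : Λ → ℝ) :
    ∫ l, f l ∂((μ univ)⁻¹ • μ) = (μ univ).toReal⁻¹ * ∫ l, f l ∂μ := by
  rw [integral_smul_measure, ENNReal.toReal_inv, smul_eq_mul]

/-- An a.e. statement for `μ` holds a.e. for the normalised measure. [folklore] -/
theorem ae_normalized_of_ae {μ : Measure Λ} {p : Λ → Prop} (h : ∀ᵐ l ∂μ, p l) : ∀ᵐ l ∂((μ univ)⁻¹ • μ), p l :=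
  Measure.ae_smul_measure h _

/-- Integrability for a finite NON-ZERO `μ` gives integrability for the normalised measure. [folklore] -/
theorem integrable_normalized {μ : Measure Λ} [NeZero μ] {f : Λ → ℝ} (h : Integrable f μ) :
    Integrable f ((μ univ)⁻¹ • μ) :=
  h.smul_measure (ENNReal.inv_ne_top.2 (NeZero.ne (μ univ)))

end Normalized

section NormalizedClauses

variable {ι : Type*} [DecidableEq ι] {Λ : ℕ → Type*} [∀ K, MeasurableSpace (Λ K)] {μ : (K : ℕ) → Measure (Λ K)}
  [∀ K, NeZero (μ K)] {l₀ vol : ℝ} {T : ℕ → Finset ι} {Bad : ℕ → ℝ → Finset ι} {W Wsh δ : ℕ → ℝ}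
  {As Bs shAs shBs : (K : ℕ) → Λ K → ℝ → ι → ℝ} {A B shA shB : ℕ → ℝ → ι → ℝ}

/-- ★★ in the COMMON-BOX FORM: the same as `hybridNE7_of_average_of_shellWeightBound` with a NON-ZERO measure `μ K` of threshold assignments per
step (e.g. `Measure.pi` of `volume.restrict [(1−κ)θ_c, θ_c]` over the occurrences of step `K`), the carriers PINNED as NORMALISED averages
`A K t τ = (μ K univ).toReal⁻¹ · ∫ As K λ t τ dμ K` (files 10b ∕ 11b ∕ 12 ∕ 14a), the sharp clauses `μ K`-a.e., integrability against `μ K`. [folklore] -/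
theorem hybridNE7_of_normalizedAverage_of_shellWeightBound
    (hAi : ∀ K t, |t| ≤ l₀ → ∀ τ ∈ T K, Integrable (fun l => As K l t τ) (μ K))
    (hBi : ∀ K t, |t| ≤ l₀ → ∀ τ ∈ T K, Integrable (fun l => Bs K l t τ) (μ K))
    (hshAi : ∀ K t, |t| ≤ l₀ → ∀ τ ∈ T K, Integrable (fun l => shAs K l t τ) (μ K))
    (hshBi : ∀ K t, |t| ≤ l₀ → ∀ τ ∈ T K, Integrable (fun l => shBs K l t τ) (μ K))
    (hA : ∀ K t, |t| ≤ l₀ → ∀ τ ∈ T K, A K t τ = (μ K univ).toReal⁻¹ * ∫ l, As K l t τ ∂(μ K))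
    (hB : ∀ K t, |t| ≤ l₀ → ∀ τ ∈ T K, B K t τ = (μ K univ).toReal⁻¹ * ∫ l, Bs K l t τ ∂(μ K))
    (hshA : ∀ K t, |t| ≤ l₀ → ∀ τ ∈ T K, shA K t τ = (μ K univ).toReal⁻¹ * ∫ l, shAs K l t τ ∂(μ K))
    (hshB : ∀ K t, |t| ≤ l₀ → ∀ τ ∈ T K, shB K t τ = (μ K univ).toReal⁻¹ * ∫ l, shBs K l t τ ∂(μ K))
    (bad_subset : ∀ K t, |t| ≤ l₀ → Bad K t ⊆ T K) (hW0 : ∀ K, 0 ≤ W K) (hWs : Summable W)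
    (hbadA : ∀ K t, |t| ≤ l₀ → ∀ᵐ l ∂(μ K), ∑ τ ∈ Bad K t, As K l t τ ≤ W K * ∑ τ ∈ T K, As K l t τ)
    (hbadB : ∀ K t, |t| ≤ l₀ → ∀ᵐ l ∂(μ K), ∑ τ ∈ Bad K t, Bs K l t τ ≤ W K * ∑ τ ∈ T K, Bs K l t τ)
    (hcore : ∀ K : ℕ, ∃ c : ℝ, ∀ t : ℝ, |t| ≤ l₀ → ∀ τ ∈ T K \ Bad K t, ∀ᵐ l ∂(μ K),
      Real.exp (c - vol * δ K) * (As K l t τ - shAs K l t τ) ≤ Bs K l t τ - shBs K l t τ ∧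
        Bs K l t τ - shBs K l t τ ≤ Real.exp (c + vol * δ K) * (As K l t τ - shAs K l t τ))
    (hSh : ShellWeightBound l₀ T A B shA shB Wsh) (hlt : ∀ K, W K + Wsh K < 1) (hδ : Summable δ) :
    HybridNE7 l₀ vol T A B Bad W shA shB Wsh δ :=
  hybridNE7_of_average_of_shellWeightBound (P := fun K => ((μ K) univ)⁻¹ • μ K)
    (fun K t ht τ hτ => integrable_normalized (hAi K t ht τ hτ)) (fun K t ht τ hτ => integrable_normalized (hBi K t ht τ hτ))
    (fun K t ht τ hτ => integrable_normalized (hshAi K t ht τ hτ)) (fun K t ht τ hτ => integrable_normalized (hshBi K t ht τ hτ))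
    (fun K t ht τ hτ => by rw [hA K t ht τ hτ, integral_normalized_eq])
    (fun K t ht τ hτ => by rw [hB K t ht τ hτ, integral_normalized_eq])
    (fun K t ht τ hτ => by rw [hshA K t ht τ hτ, integral_normalized_eq])
    (fun K t ht τ hτ => by rw [hshB K t ht τ hτ, integral_normalized_eq])
    bad_subset hW0 hWs (fun K t ht => ae_normalized_of_ae (hbadA K t ht)) (fun K t ht => ae_normalized_of_ae (hbadB K t ht))
    (fun K => by
      obtain ⟨c, hc⟩ := hcore K
      exact ⟨c, fun t ht τ hτ => ae_normalized_of_ae (hc t ht τ hτ)⟩)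
    hSh hlt hδ

end NormalizedClauses

end Summit.QuantumFields.YangMills.Theorems.N21ThresholdMixtureTransfer

end
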